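import Literature.AlgebraicGeometry.LaurentSchroer2023.ParaAbelianGroupLaw
import Literature.AlgebraicGeometry.Limits.SubalgebraGroupSpread
import Literature.AlgebraicGeometry.Morphisms.FiniteEtaleFpqcDescent
import Literature.AlgebraicGeometry.Morphisms.ReducedOfFlat
import Literature.AlgebraicGeometry.Motives.GeometricallyIntegralAlgClosed
import Literature.AlgebraicGeometry.Motives.GrpObjOfAlgPoints
import Mathlib.AlgebraicGeometry.AlgClosed.Basic
import Mathlib.AlgebraicGeometry.ZariskisMainTheorem
import HarnessLib

/-!
# A para-abelian variety with a rational point is an abelian variety — PROVED over algebraically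
# closed ground fields (Laurent–Schröer 2023, Prop. 4.3, case `S = Spec k`, `k = k̄`)

Topic `Literature/AlgebraicGeometry/LaurentSchroer2023` (family `hodge`). This file DISCHARGES the
named fact `LaurentSchroer2023.groupLaw_of_isParaAbelian_of_point k` of
`LaurentSchroer2023/ParaAbelianGroupLaw.lean` for every ALGEBRAICALLY CLOSED field `k`
(`groupLaw_of_isParaAbelian_of_point_holds`) — the generality in which the tree consumes it
(`k = ℚ̄ = AlgebraicClosure ℚ`: `Summits/HodgeConjecture/…/Ring2DeformQbarFibreDescent`, binder
`hLS`; and the two corollaries `exists_abelianVariety_of_isParaAbelian`,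
`exists_abelianVariety_baseChange_iso` of the fact file, restated unconditionally below).

Source. B. Laurent, S. Schröer, *Para-abelian varieties and Albanese maps*, Bull. Braz. Math.
Soc. (N.S.) 55 (2023/24), doi:10.1007/s00574-023-00378-0 (arXiv 2101.10829), §4, Prop. 4.3 [LaurentSchroer2023]: *"For each `e ∈ P(S)`, there is a
unique group law `μ : P ×_S P → P` that turns `P → S` into a family of abelian varieties, with
`e : S → P` as the zero section."* The printed proof (fpqc descent of the group law along
`k ⊂ k'` plus the Rigidity Lemma) needs descent of MORPHISMS, which Mathlib does not have. Over an
algebraically closed field we replace it by the classical SPECIALISATION argument (Milne,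
*Abelian Varieties* (1986), §20, proof of Cor. 20.4 / Rem. 20.9: an abelian variety over a field
extension is defined over a finitely generated subalgebra, over which the group law spreads out;
EGA IV₃ 8.8.2), entirely with results already in the tree:

1. `IsParaAbelian P` gives a field `L ⊇ k` and an abelian variety `A'` over `L` with
   `A'.X ≅ P_L = P ×_k Spec L`; transport the group structure to `P_L` (`GrpObj.ofIso`).
2. PROPERTIES OF `P` by descent along the fpqc cover `P_L → P`: `P` is integral
   (`Morphisms.ReducedOfFlat`, irreducible image), hence geometrically integral since `k = k̄`
   (`Motives.geometricallyIntegral_of_isAlgClosed`, Görtz–Wedhorn I 5.56); quasi-compact;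
   separated (`isSeparated_of_isPullback`: the diagonal is a monomorphism whose universal
   closedness descends — Mathlib's fpqc descent — and a proper monomorphism is a closed immersion,
   Mathlib `IsClosedImmersion.iff_isProper_and_mono`); proper
   (`Morphisms.FiniteEtaleFpqcDescent.isProper_of_isPullback`).
3. SPREADING OUT (EGA IV₃ 8.8.2 for group laws, `Limits/SubalgebraGroupSpread`, the twin of the
   tree's `Limits/LocalizationGroupSpread`): `L = ⋃ k[t]` over its finitely generated
   `k`-subalgebras and `P_L = lim P ×_k Spec k[t]`, so the group structure of `P_L` descends to a
   group-scheme structure on some stage `P ×_k Spec k[t]` over `k[t]`.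
4. SPECIALISATION: `k[t] ⊆ L` is a finitely generated `k`-algebra and a domain, so `Spec k[t]`
   has a `k`-rational point `x` (Hilbert's Nullstellensatz, Mathlib `pointOfClosedPoint`); base
   change along `x` (a monoidal functor, Mathlib `Functor.grpObjObj`) gives a group structure on
   `(P ×_k Spec k[t]) ×_{k[t],x} Spec k ≅ P` (transitivity of base change,
   `Limits/SliceBaseChange.pullbackFacObjIso`, and `Over.pullbackId`).
5. THE ZERO: right translation by the prescribed point `e` (Mathlib `GrpObj.mulRight`) is an
   automorphism of `P` carrying the unit to `e`; transporting the structure along it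
   (`GrpObj.ofIso`) makes `e` the zero (Mumford, *Abelian Varieties*, §4: translations).

What is NOT proved here: the case of a general ground field `k` (Prop. 4.3 as printed: fpqc /
Galois descent of the group law), uniqueness of the group law, general bases `S`
(`-- TODO(general form)` of the fact file stands). No new definitions, no new named facts; the
statement discharged is literally `groupLaw_of_isParaAbelian_of_point k` under `[IsAlgClosed k]`.

## References

* [LaurentSchroer2023] B. Laurent, S. Schröer, *Para-abelian varieties and Albanese maps*, §4 Prop. 4.3.
* [Milne1986AbelianVarieties] J. S. Milne, *Abelian Varieties*, in Cornell–Silverman (1986), §20 (Cor. 20.4, Rem. 20.9).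
* [EGAIV3] A. Grothendieck, EGA IV₃, Thm. 8.8.2.
* [MumfordAV1970] D. Mumford, *Abelian Varieties*, §4.
* [GortzWedhorn2020] U. Görtz, T. Wedhorn, *Algebraic Geometry I*, 2nd ed., Prop. 5.51, Cor. 5.56, Prop. 9.19, Rem. 9.20.
* [StacksProject] The Stacks project, Tags 02KS, 02KZ, 02L1 (fpqc descent), 04XV (proper monomorphisms).
-/

noncomputable section

open CategoryTheory CategoryTheory.Limits AlgebraicGeometry MonoidalCategory
  CartesianMonoidalCategory MonObj

universe u

namespace Literature.AlgebraicGeometry.LaurentSchroer2023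

open Literature.AlgebraicGeometry.Motives Literature.AlgebraicGeometry.Limits

set_option backward.isDefEq.respectTransparency false

/-! ## Descent of separatedness and integrality along an fpqc cover -/

/-- **Separatedness descends along fpqc covers** (Stacks 02KU): for a cartesian square
`IsPullback fst snd f g` with `f` surjective, flat and quasi-compact, if the base change `fst` of
`g` is separated then `g` is separated. Proof from Mathlib's fpqc descent of universal closedness:
the diagonal of `g` is a monomorphism (hence separated), an immersion (hence locally of finite
type), and universally closed because the diagonal of `fst` — its base change — is a closed
immersion (Mathlib: `P.diagonal` descends when `P` does); a proper monomorphism is a closed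
immersion (Mathlib `IsClosedImmersion.iff_isProper_and_mono`, Stacks 04XV).
[cite: StacksProject, Tag 02KU] -/
theorem isSeparated_of_isPullback {P X Y Z : Scheme.{u}} {fst : P ⟶ X} {snd : P ⟶ Y} {f : X ⟶ Z}
    {g : Y ⟶ Z} (h : IsPullback fst snd f g) [Surjective f] [Flat f] [QuasiCompact f]
    [IsSeparated fst] : IsSeparated g := by
  have hf : (@Surjective ⊓ @Flat ⊓ @QuasiCompact : MorphismProperty Scheme) f := ⟨⟨‹_›, ‹_›⟩, ‹_›⟩
  have hUC : (MorphismProperty.diagonal @UniversallyClosed) g :=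
    MorphismProperty.of_isPullback_of_descendsAlong
      (P := MorphismProperty.diagonal @UniversallyClosed)
      (Q := @Surjective ⊓ @Flat ⊓ @QuasiCompact) h hf
      (show UniversallyClosed (pullback.diagonal fst) from inferInstance)
  haveI : UniversallyClosed (pullback.diagonal g) := hUC
  haveI : IsProper (pullback.diagonal g) := {}
  exact ⟨(IsClosedImmersion.iff_isProper_and_mono _).mpr ⟨inferInstance, inferInstance⟩⟩

/-- **Integrality descends along flat surjective morphisms**: if `π : X ⟶ Y` is flat and
surjective and `X` is integral, then `Y` is integral (reducedness by
`Morphisms.isReduced_of_flat_of_surjective`, irreducibility as the continuous image of an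
irreducible space). [cite: StacksProject, Tag 033E] -/
theorem isIntegral_of_flat_of_surjective {X Y : Scheme.{u}} (π : X ⟶ Y) [Flat π] [Surjective π]
    [IsIntegral X] : IsIntegral Y := by
  haveI : IsReduced Y := Morphisms.isReduced_of_flat_of_surjective π
  haveI : IrreducibleSpace Y := by
    rw [irreducibleSpace_def]
    have h : IsIrreducible (Set.range π) := by
      rw [← Set.image_univ]
      exact (IrreducibleSpace.isIrreducible_univ X).image _ π.continuous.continuousOn
    rwa [π.surjective.range_eq] at h
  exact isIntegral_of_irreducibleSpace_of_isReduced Y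

/-! ## Re-pointing the unit of a group object by a translation -/

section Translate

variable {C : Type*} [Category C] [CartesianMonoidalCategory C] {G : C}

/-- **Translations move the origin**: for a group object `G` and a point `e : 𝟙 ⟶ G`, transporting
the group structure along the right translation `(· * e) : G ≅ G` (Mathlib `GrpObj.mulRight`)
gives a group structure on `G` whose unit is `e` (Mumford, *Abelian Varieties*, §4: the group law
with a translated origin). [cite: MumfordAV1970, §4] -/
theorem ofIso_mulRight_one (hG : GrpObj G) (e : 𝟙_ C ⟶ G) :
    (GrpObj.ofIso (GrpObj.mulRight (A := G) e)).one = e := by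
  rw [GrpObj.ofIso, MonObj.ofIso_one, GrpObj.mulRight_hom, comp_lift_assoc, Category.comp_id]
  have h1 : η[G] ≫ toUnit G ≫ e = e := by
    rw [← Category.assoc, toUnit_unique (η[G] ≫ toUnit G) (𝟙 _), Category.id_comp]
  rw [h1]
  have h2 : lift η[G] e = e ≫ lift (toUnit G ≫ η[G]) (𝟙 G) := by
    rw [comp_lift, Category.comp_id, ← Category.assoc, toUnit_unique (e ≫ toUnit G) (𝟙 _),
      Category.id_comp]
  rw [h2, Category.assoc, lift_comp_one_left]
  simp

end Translate

/-! ## The theorem -/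

/-- **Laurent–Schröer 2023, Prop. 4.3 over an algebraically closed field (PROVED).** For `k`
algebraically closed, every para-abelian `k`-scheme `P` (`IsParaAbelian P`: `P ⊗_k L ≅ A'.X` for an
abelian variety `A'` over some field `L ⊇ k`) with a rational point `e ∈ P(k)` is the underlying
`k`-scheme of an abelian variety over `k` with zero `e`: the named fact
`groupLaw_of_isParaAbelian_of_point k` holds. Proof by spreading out the group law of `P_L` to a
finitely generated `k`-subalgebra `k[t] ⊆ L` (EGA IV₃ 8.8.2, `Limits/SubalgebraGroupSpread`),
specialising at a `k`-point of `Spec k[t]` (Nullstellensatz), and translating the origin to `e`;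
properness and (geometric) integrality of `P` descend along the fpqc cover `P_L → P`. The general
case (arbitrary `k`, fpqc descent of the group law as printed) is not proved here.
[cite: LaurentSchroer2023, §4 Prop. 4.3 (case S = Spec k, k algebraically closed)]
[cite: Milne1986AbelianVarieties, §20 Cor. 20.4 and Rem. 20.9 (spreading out and specialising an abelian variety)]
[cite: EGAIV3, Thm. 8.8.2] -/
theorem groupLaw_of_isParaAbelian_of_point_holds (k : Type u) [Field k] [IsAlgClosed k] :
    groupLaw_of_isParaAbelian_of_point k := by
  intro P hP e
  obtain ⟨L, _, _, A', ⟨φ⟩⟩ := hP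
  -- (0) notation: the cover `Spec L → Spec k`, `P_L`, the projection `π : P_L → P`
  let i : Spec (.of L) ⟶ Spec (.of k) := Spec.map (CommRingCat.ofHom (algebraMap k L))
  let PL : SchemeOver L := SubalgGrpSpread.limObj L P
  have φ' : A'.X ≅ PL := φ
  let π : PL.left ⟶ P.left := pullback.fst P.hom i
  have hsq : IsPullback (pullback.snd P.hom i) π i P.hom := (IsPullback.of_hasPullback P.hom i).flip
  -- `Spec L → Spec k` is an fpqc cover
  have hff : (CommRingCat.ofHom (algebraMap k L)).hom.FaithfullyFlat := by
    rw [CommRingCat.hom_ofHom, RingHom.faithfullyFlat_algebraMap_iff]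
    infer_instance
  obtain ⟨_, hisurj⟩ := (flat_and_surjective_SpecMap_iff _).2 hff
  haveI : Surjective i := hisurj
  haveI : Flat i := inferInstance
  haveI : QuasiCompact i := inferInstance
  haveI : Surjective π := MorphismProperty.pullback_fst _ _ ‹Surjective i›
  haveI : Flat π := inferInstance
  -- (1) the group structure on `P_L`, transported from `A'`
  letI instPL : GrpObj PL := GrpObj.ofIso φ'
  -- (2) properties of `P_L` (from `A'`) and of `P` (by descent)
  haveI : IsIntegral A'.X.left := SchemeOver.isIntegral_left A'.X
  haveI : Flat φ'.hom.left := inferInstance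
  haveI : Surjective φ'.hom.left := inferInstance
  haveI : IsIntegral PL.left := isIntegral_of_flat_of_surjective φ'.hom.left
  haveI : IsIntegral P.left := isIntegral_of_flat_of_surjective π
  have hGI : GeometricallyIntegral P.hom := geometricallyIntegral_of_isAlgClosed (k := k) P.hom
  haveI : IsProper PL.hom := by
    have e1 : PL.hom = φ'.inv.left ≫ A'.X.hom := (Over.w φ'.inv).symm
    rw [e1]; infer_instance
  haveI : IsProper (pullback.snd P.hom i) := ‹IsProper PL.hom›
  haveI : IsSeparated P.hom := isSeparated_of_isPullback hsq
  have hPr : IsProper P.hom := Morphisms.isProper_of_isPullback hsq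
  haveI : CompactSpace PL.left := by
    haveI : CompactSpace ↥(Spec (CommRingCat.of L)) := inferInstance
    exact QuasiCompact.compactSpace_of_compactSpace PL.hom
  haveI : CompactSpace P.left := ⟨by
    rw [← π.surjective.range_eq, ← Set.image_univ]
    exact isCompact_univ.image π.continuous⟩
  haveI : QuasiCompact P.hom := (HasAffineProperty.iff_of_isAffine (P := @QuasiCompact)).mpr ‹_›
  haveI : LocallyOfFiniteType P.hom := hPr.toLocallyOfFiniteType
  haveI : LocallyOfFinitePresentation P.hom := inferInstance
  -- (3) spreading out: a stage `P ×_k Spec k[t]` with a group structure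
  obtain ⟨t, Gt, -⟩ := SubalgGrpSpread.exists_stage_grpObj L (∅ : Finset L) P
  letI := Gt
  -- the stage base `T = Spec k[t]`, a `k`-scheme of finite type with `k[t]` a domain
  let R := SubalgApprox.sub k L t.unop.1
  let T : SchemeOver k := (SubalgApprox.baseDiagram k L (∅ : Finset L)).obj t
  -- (4) a `k`-point of `T` (Nullstellensatz) and specialisation
  haveI : Nontrivial R := inferInstance
  obtain ⟨𝔪, h𝔪⟩ := Ideal.exists_maximal R
  let x₀ : T.left := (⟨𝔪, h𝔪.isPrime⟩ : PrimeSpectrum R)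
  have hx₀ : IsClosed ({x₀} : Set T.left) :=
    (PrimeSpectrum.isClosed_singleton_iff_isMaximal _).mpr h𝔪
  haveI : LocallyOfFiniteType T.hom := inferInstance
  let x : Spec (.of k) ⟶ T.left := pointOfClosedPoint T.hom x₀ hx₀
  have hx : x ≫ T.hom = 𝟙 _ := pointOfClosedPoint_comp T.hom x₀ hx₀
  letI Gx : GrpObj ((Over.pullback x).obj (SubalgGrpSpread.stageObj L ∅ P t)) :=
    Functor.grpObjObj (F := Over.pullback x) (G := SubalgGrpSpread.stageObj L ∅ P t)
  let ψ : (Over.pullback x).obj (SubalgGrpSpread.stageObj L ∅ P t) ≅ P :=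
    pullbackFacObjIso T.hom x (𝟙 _) hx P ≪≫ Over.pullbackId.app P
  letI G₁ : GrpObj P := GrpObj.ofIso ψ
  -- (5) translate the origin to `e`
  let ι₁ : 𝟙_ (SchemeOver k) ≅ specOver k k :=
    Over.isoMk (Iso.refl _) (by
      change 𝟙 _ ≫ Spec.map (CommRingCat.ofHom (algebraMap k k)) = 𝟙 _
      rw [Algebra.algebraMap_self, CommRingCat.ofHom_id]
      erw [Spec.map_id]
      simp)
  let e' : 𝟙_ (SchemeOver k) ⟶ P := ι₁.hom ≫ e
  let G₂ : GrpObj P := GrpObj.ofIso (GrpObj.mulRight (A := P) e')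
  have hone : @MonObj.one _ _ _ P G₂.toMonObj = e' := ofIso_mulRight_one G₁ e'
  refine ⟨{ X := P, grpObj := G₂, isProper := hPr, geometricallyIntegral := hGI }, rfl, ?_⟩
  rw [eqToHom_refl, Category.comp_id]
  change toUnit (specOver k k) ≫ @MonObj.one _ _ _ P G₂.toMonObj = e
  rw [hone]
  change toUnit (specOver k k) ≫ ι₁.hom ≫ e = e
  rw [← Category.assoc]
  have hid : toUnit (specOver k k) ≫ ι₁.hom = 𝟙 _ := by
    haveI : Mono (specOver k k).hom := by
      change Mono (Spec.map (CommRingCat.ofHom (algebraMap k k)))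
      rw [Algebra.algebraMap_self, CommRingCat.ofHom_id]
      erw [Spec.map_id]
      infer_instance
    ext : 1
    exact (cancel_mono (specOver k k).hom).1 (by rw [Over.w, Over.w])
  rw [hid, Category.id_comp]

/-! ## The corollaries of the fact file, now unconditional over algebraically closed fields -/

/-- **Every para-abelian scheme over an algebraically closed field is the underlying scheme of an
abelian variety** — the corollary `exists_abelianVariety_of_isParaAbelian` of the fact file with its
hypothesis `groupLaw_of_isParaAbelian_of_point k` discharged by
`groupLaw_of_isParaAbelian_of_point_holds`. [cite: LaurentSchroer2023, §4 Prop. 4.3 (case S = Spec k, k algebraically closed)] -/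
theorem IsParaAbelian.exists_abelianVariety {k : Type u} [Field k] [IsAlgClosed k] {P : SchemeOver k}
    (hP : IsParaAbelian P) : ∃ A : AbelianVariety k, A.X = P :=
  exists_abelianVariety_of_isParaAbelian (groupLaw_of_isParaAbelian_of_point_holds k) hP

/-- **Descent form, unconditional**: for `k` algebraically closed, an abelian variety `A'` over a
field `L ⊇ k` whose underlying `L`-scheme is `P ⊗_k L` for a `k`-scheme `P` comes from an abelian
variety `A` over `k` with `A.X = P`, `dim A = dim A'` and `A ⊗_k L ≅ A'.X` — the corollary
`exists_abelianVariety_baseChange_iso` of the fact file with its hypothesis discharged (the shape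
used for the descent of an abelian complex fibre over a `ℚ̄`-point to `ℚ^al ⊂ ℂ`).
[cite: LaurentSchroer2023, §4 Prop. 4.3 (case S = Spec k, k algebraically closed)] -/
theorem IsParaAbelian.exists_abelianVariety_baseChange_iso {k : Type u} [Field k] [IsAlgClosed k]
    {P : SchemeOver k} {L : Type u} [Field L] [Algebra k L] (A' : AbelianVariety L)
    (e : A'.X ≅ (Motives.baseChange k L).obj P) :
    ∃ A : AbelianVariety k, A.X = P ∧ A.dim = A'.dim ∧ Nonempty ((A.baseChange L).X ≅ A'.X) :=
  _root_.Literature.AlgebraicGeometry.LaurentSchroer2023.exists_abelianVariety_baseChange_iso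
    (groupLaw_of_isParaAbelian_of_point_holds k) A' e

end Literature.AlgebraicGeometry.LaurentSchroer2023

end
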